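import Literature.NumberTheory.Sieve.IwaniecAlmostPrimesQuadraticPhase
import HarnessLib

/-!
# Iwaniec (1978) for a general quadratic `G`: the exponential sum over one slice of a fundamental domain — PROVED

H. Iwaniec, *Almost-primes represented by quadratic polynomials*, Invent. Math. **47** (1978)
171–188, §4 p. 180 (the estimation of the sum (11) after Lemma 5: Lemma 6 on the intervals of
`r`, Abel summation against the slowly varying second factor), carried out for a general form
`Φ = (A, B, C)` in the coordinates `v = (u, s)` of `IwaniecAlmostPrimesQuadraticPhase.lean`
(where the phase is `e(hΘ/D) = e(h ū/s) · twistG`).  For a fixed height `s ≥ 1` the points `u` of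
a slice on which `P(u) = Φ(u, s)` is monotone, `P ≥ T₁`, `ℓ² ≤ κ A P` (`ℓ = 2Au + Bs`; `κ = 4`
for a definite form, `κ = 4 + η⁴` on Hooley's sector of an indefinite one) and `P ≥ A(u − u₀)²`:

* `norm_sum_mul_le_of_tv` — Abel summation against a weight of norm `≤ 1` and total variation
  `≤ V`: `‖∑ aᵢ gᵢ‖ ≤ M (1 + V)`;
* `norm_sum_Ioo_filter_hooley_mul_le_tv` (an interval of length `< 2s`, Lemma 6 for the partial
  sums) and `norm_sum_Ioo_filter_hooley_mul_le_long` (any interval, cut into pieces of length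
  `s`): `‖∑_{u₁<u<u₂, (u,s)=1, u≡λ (Λ)} e(h ū/s) g(u)‖ ≤ C s^{1/2+ε} √(h,s) ((u₂−u₁)/s + 1 + V)`;
* `sum_inv_le_of_sq_le` — `∑_{u} 1/P(u) ≤ 7/√T` when `P ≥ max(T, (u − u₀)²)` along an interval;
* `twistG_succ_sub` bookkeeping: `ℓ(u+1) = ℓ(u) + 2A`, `P(u+1) = P(u) + ℓ(u) + A`,
  `ℓ' P − ℓ P' = 2AP − ℓ² − Aℓ`, whence `|Δ (ℓ/(2sP))| ≤ (1+κ)A²/(s P(u+1))`, and the telescoping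
  `∑ |Δ(1/P)| = |1/P(first) − 1/P(last)| ≤ 1/T₁` on a monotone piece;
* **`norm_sliceSumG_le`** — the slice estimate:
  `‖∑_{u₁<u<u₂, (u,s)=1, u≡λ (Λ)} e(h ū/s) twistG(u)‖ ≤ C s^{1/2+ε} √(h,s) ((u₂−u₁)/s + 1 + 2π|h| (7(1+κ)A²/(s√T₁) + |b|/T₁))`.

Everything here is PROVED (the input "Lemma 6" enters as the hypothesis `hC`, the conclusion of
the tree's proved `lemma6_hooley`); no named facts.

## References

* H. Iwaniec, Invent. Math. 47 (1978) 171–188, §4 p. 180, Lemmas 5–6 (`IwaniecInventiones1978`).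
* C. Hooley, Acta Math. 117 (1967), §6 (the slices of the fundamental domains) (`Hooley1967`).
-/

noncomputable section

open Finset Real
open scoped FourierTransform

namespace Literature.NumberTheory.Sieve.Iwaniec1978

open Literature.NumberTheory.QuadraticFields.Quadratic (BinQF)
open Literature.NumberTheory.Sieve.Vinogradov (norm_fourierChar)

/-! ### Abel summation against a weight of bounded total variation -/

/-- **Abel's inequality, total-variation form**: if the partial sums of `a` are bounded by `M ≥ 0`
and `g` has norm `≤ 1` and total variation `≤ V` along `0, …, n−1`, then
`‖∑_{i<n} aᵢ gᵢ‖ ≤ M (1 + V)`. [folklore] -/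
theorem norm_sum_mul_le_of_tv {n : ℕ} {a g : ℕ → ℂ} {M V : ℝ} (hM : 0 ≤ M)
    (ha : ∀ k, k ≤ n → ‖∑ i ∈ Finset.range k, a i‖ ≤ M) (hg : ∀ i, ‖g i‖ ≤ 1)
    (hTV : ∑ i ∈ Finset.range (n - 1), ‖g (i + 1) - g i‖ ≤ V) :
    ‖∑ i ∈ Finset.range n, a i * g i‖ ≤ M * (1 + V) :=
  (norm_sum_mul_le_of_partialSums ha).trans
    (mul_le_mul_of_nonneg_left (add_le_add (hg _) hTV) hM)

section IntervalLemmas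

variable {ε C : ℝ}

/-- The total variation of `g` along the integer interval `(u₁, u₂)`:
`∑_{u₁ < u, u+1 < u₂} ‖g(u+1) − g(u)‖`. [folklore] -/
def tvIoo (g : ℤ → ℂ) (u₁ u₂ : ℤ) : ℝ :=
  ∑ u ∈ Finset.Ioo u₁ (u₂ - 1), ‖g (u + 1) - g u‖

/-- `tvIoo ≥ 0`. [folklore] -/
theorem tvIoo_nonneg (g : ℤ → ℂ) (u₁ u₂ : ℤ) : 0 ≤ tvIoo g u₁ u₂ :=
  Finset.sum_nonneg fun _ _ => norm_nonneg _

/-- Splitting the interval at `m` (`u₁ ≤ m < u₂`) does not increase the total variation: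
`tvIoo g u₁ (m+1) + tvIoo g m u₂ ≤ tvIoo g u₁ u₂`. [folklore] -/
theorem tvIoo_split_le (g : ℤ → ℂ) {u₁ m u₂ : ℤ} (h₁ : u₁ ≤ m) (h₂ : m < u₂) :
    tvIoo g u₁ (m + 1) + tvIoo g m u₂ ≤ tvIoo g u₁ u₂ := by
  unfold tvIoo
  have hsub : Finset.Ioo u₁ (m + 1 - 1) ∪ Finset.Ioo m (u₂ - 1) ⊆ Finset.Ioo u₁ (u₂ - 1) := by
    intro u hu
    simp only [Finset.mem_union, Finset.mem_Ioo] at hu ⊢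
    omega
  have hdisj : Disjoint (Finset.Ioo u₁ (m + 1 - 1)) (Finset.Ioo m (u₂ - 1)) := by
    rw [Finset.disjoint_left]
    intro u hu hu'
    simp only [Finset.mem_Ioo] at hu hu'
    omega
  rw [← Finset.sum_union hdisj]
  exact Finset.sum_le_sum_of_subset_of_nonneg hsub fun _ _ _ => norm_nonneg _

/-- **A short interval** (`u₂ − u₁ < 2s`): Lemma 6 for the partial sums and Abel summation against
a weight `g` of norm `≤ 1`:
`‖∑_{u₁<u<u₂, (u,s)=1, u≡λ (Λ)} e(h ū/s) g(u)‖ ≤ C s^{1/2+ε} √(h,s) (1 + tvIoo g u₁ u₂)`.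
[cite: IwaniecInventiones1978, §4 p. 180] -/
theorem norm_sum_Ioo_filter_hooley_mul_le_tv
    (hC : ∀ (s Λ : ℕ) (h r₁ r₂ lam : ℤ), 1 ≤ s → 1 ≤ Λ → r₁ < r₂ → r₂ - r₁ < 2 * s →
      ‖∑ r ∈ (Finset.Ioo r₁ r₂).filter (fun r : ℤ => Int.gcd r s = 1 ∧ r ≡ lam [ZMOD Λ]),
          hooleyPhase h s r‖ ≤ C * (s : ℝ) ^ (1 / 2 + ε) * Real.sqrt (Int.gcd h s))
    {s Λ : ℕ} (hs : 1 ≤ s) (hΛ : 1 ≤ Λ) (h lam u₁ u₂ : ℤ) (hlen : u₂ - u₁ < 2 * s)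
    (g : ℤ → ℂ) (hg : ∀ u, ‖g u‖ ≤ 1) :
    ‖∑ u ∈ (Finset.Ioo u₁ u₂).filter (fun u : ℤ => Int.gcd u s = 1 ∧ u ≡ lam [ZMOD Λ]),
        hooleyPhase h s u * g u‖ ≤
      C * (s : ℝ) ^ (1 / 2 + ε) * Real.sqrt (Int.gcd h s) * (1 + tvIoo g u₁ u₂) := by
  set M : ℝ := C * (s : ℝ) ^ (1 / 2 + ε) * Real.sqrt (Int.gcd h s) with hMdef
  have hM0 : 0 ≤ M := by
    have := hC s Λ h 0 1 lam hs hΛ zero_lt_one (by push_cast; omega)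
    exact (norm_nonneg _).trans this
  have hTV0 := tvIoo_nonneg g u₁ u₂
  -- the empty case
  rcases le_or_gt u₂ (u₁ + 1) with hemp | hne
  · have : Finset.Ioo u₁ u₂ = ∅ := by
      ext x; simp only [Finset.mem_Ioo, Finset.notMem_empty, iff_false]; omega
    rw [this, Finset.filter_empty, Finset.sum_empty, norm_zero]
    positivity
  -- the index change `u = u₁ + 1 + i`, `i < N = u₂ - u₁ - 1`
  set N : ℕ := (u₂ - u₁ - 1).toNat with hN
  have hNeq : (N : ℤ) = u₂ - u₁ - 1 := Int.toNat_of_nonneg (by omega)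
  set ρ : ℕ → ℤ := fun i => u₁ + 1 + i with hρ
  have himage : ∀ k : ℕ, k ≤ N → Finset.Ioo u₁ (u₁ + 1 + k) = (Finset.range k).image ρ := by
    intro k _
    ext x
    simp only [Finset.mem_Ioo, Finset.mem_image, Finset.mem_range, hρ]
    constructor
    · rintro ⟨h0, hk⟩
      refine ⟨(x - u₁ - 1).toNat, ?_, ?_⟩
      · have : ((x - u₁ - 1).toNat : ℤ) = x - u₁ - 1 := Int.toNat_of_nonneg (by omega)
        omega
      · have : ((x - u₁ - 1).toNat : ℤ) = x - u₁ - 1 := Int.toNat_of_nonneg (by omega)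
        omega
    · rintro ⟨i, hi, rfl⟩
      constructor <;> omega
  have hinj : ∀ k : ℕ, Set.InjOn ρ (Finset.range k : Set ℕ) := by
    intro k i _ j _ hij
    simp only [hρ] at hij
    exact_mod_cast (add_left_cancel hij)
  set a : ℕ → ℂ := fun i => if Int.gcd (ρ i) s = 1 ∧ ρ i ≡ lam [ZMOD Λ] then hooleyPhase h s (ρ i)
    else 0 with hadef
  set w : ℕ → ℂ := fun i => g (ρ i) with hwdef
  have hpartial : ∀ k, k ≤ N → ‖∑ i ∈ Finset.range k, a i‖ ≤ M := by
    intro k hk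
    have heq : ∑ i ∈ Finset.range k, a i =
        ∑ r ∈ (Finset.Ioo u₁ (u₁ + 1 + k)).filter
          (fun r : ℤ => Int.gcd r s = 1 ∧ r ≡ lam [ZMOD Λ]), hooleyPhase h s r := by
      rw [Finset.sum_filter, himage k hk, Finset.sum_image (hinj k)]
    rw [heq]
    have hk' : (k : ℤ) ≤ N := by exact_mod_cast hk
    exact hC s Λ h u₁ (u₁ + 1 + k) lam hs hΛ (by omega) (by omega)
  have hsum : ∑ u ∈ (Finset.Ioo u₁ u₂).filter (fun u : ℤ => Int.gcd u s = 1 ∧ u ≡ lam [ZMOD Λ]),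
        hooleyPhase h s u * g u = ∑ i ∈ Finset.range N, a i * w i := by
    have hu₂ : u₂ = u₁ + 1 + N := by omega
    rw [Finset.sum_filter, hu₂, himage N le_rfl, Finset.sum_image (hinj _)]
    refine Finset.sum_congr rfl fun i _ => ?_
    simp only [hadef, hwdef]
    split_ifs <;> ring
  rw [hsum]
  have hρsucc : ∀ i : ℕ, ρ (i + 1) = ρ i + 1 := fun i => by simp only [hρ]; push_cast; ring
  -- the total variation of `w` is that of `g` along the interval
  have hTV : ∑ i ∈ Finset.range (N - 1), ‖w (i + 1) - w i‖ ≤ tvIoo g u₁ u₂ := by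
    unfold tvIoo
    have hN1 : N - 1 ≤ N := Nat.sub_le N 1
    have him : Finset.Ioo u₁ (u₂ - 1) = (Finset.range (N - 1)).image ρ := by
      have h1 : u₂ - 1 = u₁ + 1 + ((N - 1 : ℕ) : ℤ) := by
        have hN1' : 1 ≤ N := by omega
        push_cast [Nat.cast_sub hN1']
        omega
      rw [h1]; exact himage (N - 1) hN1
    rw [him, Finset.sum_image (hinj _)]
    refine le_of_eq (Finset.sum_congr rfl fun i _ => ?_)
    simp only [hwdef, hρsucc]
  exact norm_sum_mul_le_of_tv hM0 hpartial (fun i => hg _) hTV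

/-- **A long interval**, cut into pieces of length `s`:
`‖∑_{u₁<u<u₂, (u,s)=1, u≡λ (Λ)} e(h ū/s) g(u)‖ ≤ C s^{1/2+ε} √(h,s) ((u₂ − u₁)/s + 1 + tvIoo g u₁ u₂)`
for `u₁ ≤ u₂` (the constant of Lemma 6 being taken `≥ 1`). [cite: IwaniecInventiones1978, §4 p. 180] -/
theorem norm_sum_Ioo_filter_hooley_mul_le_long
    (hC : ∀ (s Λ : ℕ) (h r₁ r₂ lam : ℤ), 1 ≤ s → 1 ≤ Λ → r₁ < r₂ → r₂ - r₁ < 2 * s →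
      ‖∑ r ∈ (Finset.Ioo r₁ r₂).filter (fun r : ℤ => Int.gcd r s = 1 ∧ r ≡ lam [ZMOD Λ]),
          hooleyPhase h s r‖ ≤ C * (s : ℝ) ^ (1 / 2 + ε) * Real.sqrt (Int.gcd h s))
    (hC1 : 1 ≤ C) {s Λ : ℕ} (hs : 1 ≤ s) (hΛ : 1 ≤ Λ) (h lam : ℤ) (g : ℤ → ℂ) (hg : ∀ u, ‖g u‖ ≤ 1)
    {u₁ u₂ : ℤ} (hle : u₁ ≤ u₂) :
    ‖∑ u ∈ (Finset.Ioo u₁ u₂).filter (fun u : ℤ => Int.gcd u s = 1 ∧ u ≡ lam [ZMOD Λ]),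
        hooleyPhase h s u * g u‖ ≤
      C * (s : ℝ) ^ (1 / 2 + ε) * Real.sqrt (Int.gcd h s) *
        (((u₂ - u₁ : ℤ) : ℝ) / s + 1 + tvIoo g u₁ u₂) := by
  set M : ℝ := C * (s : ℝ) ^ (1 / 2 + ε) * Real.sqrt (Int.gcd h s) with hMdef
  have hM0 : 0 ≤ M := by
    have := hC s Λ h 0 1 lam hs hΛ zero_lt_one (by push_cast; omega)
    exact (norm_nonneg _).trans this
  have hs0 : (0 : ℝ) < s := by exact_mod_cast hs
  -- induction on the length
  suffices H : ∀ n : ℕ, ∀ u₁ u₂ : ℤ, u₂ - u₁ = n →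
      ‖∑ u ∈ (Finset.Ioo u₁ u₂).filter (fun u : ℤ => Int.gcd u s = 1 ∧ u ≡ lam [ZMOD Λ]),
          hooleyPhase h s u * g u‖ ≤ M * (((u₂ - u₁ : ℤ) : ℝ) / s + 1 + tvIoo g u₁ u₂) by
    exact H (u₂ - u₁).toNat u₁ u₂ (Int.toNat_of_nonneg (by omega)).symm
  intro n
  induction n using Nat.strong_induction_on with
  | _ n ih =>
    intro u₁ u₂ hn
    have hTV0 := tvIoo_nonneg g u₁ u₂
    have hlen0 : (0 : ℝ) ≤ ((u₂ - u₁ : ℤ) : ℝ) / s := by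
      apply div_nonneg _ hs0.le; exact_mod_cast (by omega : (0 : ℤ) ≤ u₂ - u₁)
    by_cases hshort : u₂ - u₁ < 2 * (s : ℤ)
    · -- one piece
      have h1 := norm_sum_Ioo_filter_hooley_mul_le_tv hC hs hΛ h lam u₁ u₂ hshort g hg
      refine h1.trans (mul_le_mul_of_nonneg_left (by linarith) hM0)
    · -- split off the first `s` points: `(u₁, u₁ + s]` and `(u₁ + s, u₂)`
      push Not at hshort
      set m : ℤ := u₁ + s with hm
      have hm₁ : u₁ ≤ m := by omega
      have hm₂ : m < u₂ := by omega
      have hsplit : Finset.Ioo u₁ u₂ = Finset.Ioo u₁ (m + 1) ∪ Finset.Ioo m u₂ := by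
        ext u; simp only [Finset.mem_union, Finset.mem_Ioo]; omega
      have hdisj : Disjoint (Finset.Ioo u₁ (m + 1)) (Finset.Ioo m u₂) := by
        rw [Finset.disjoint_left]; intro u hu hu'
        simp only [Finset.mem_Ioo] at hu hu'; omega
      rw [hsplit, Finset.filter_union, Finset.sum_union (Finset.disjoint_filter_filter hdisj)]
      -- first piece: short (length `s + 1 ≤ 2s` needs `s ≥ 1`; for `s = 1` it is `< 2` iff... use `m + 1 - u₁ = s + 1`)
      have hfirst : ‖∑ u ∈ (Finset.Ioo u₁ (m + 1)).filter
          (fun u : ℤ => Int.gcd u s = 1 ∧ u ≡ lam [ZMOD Λ]), hooleyPhase h s u * g u‖ ≤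
          M * (1 + tvIoo g u₁ (m + 1)) := by
        by_cases hs1 : s = 1
        · -- `s = 1`: the piece is the single point `u₁ + 1`; trivial bound `1 ≤ M`
          subst hs1
          have hI : Finset.Ioo u₁ (m + 1) = {u₁ + 1} := by
            ext u; simp only [Finset.mem_Ioo, Finset.mem_singleton, hm]; push_cast; omega
          rw [hI, Finset.filter_singleton]
          have hM1 : 1 ≤ M := by
            rw [hMdef]; simp only [Nat.cast_one, Real.one_rpow, mul_one]
            have hg1 : (1 : ℝ) ≤ Real.sqrt (Int.gcd h 1) := by simp
            nlinarith
          have hTV1 := tvIoo_nonneg g u₁ (m + 1)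
          split_ifs
          · rw [Finset.sum_singleton, norm_mul, norm_hooleyPhase, one_mul]
            calc ‖g (u₁ + 1)‖ ≤ 1 := hg _
              _ ≤ M * (1 + tvIoo g u₁ (m + 1)) := by nlinarith
          · rw [Finset.sum_empty, norm_zero]; positivity
        · have hs2 : (2 : ℤ) ≤ s := by omega
          exact norm_sum_Ioo_filter_hooley_mul_le_tv hC hs hΛ h lam u₁ (m + 1) (by omega) g hg
      -- second piece: induction
      have hn' : (u₂ - m).toNat < n := by
        have : ((u₂ - m).toNat : ℤ) = u₂ - m := Int.toNat_of_nonneg (by omega)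
        omega
      have hsecond := ih _ hn' m u₂ (Int.toNat_of_nonneg (by omega)).symm
      have htv := tvIoo_split_le g hm₁ hm₂
      calc _ ≤ M * (1 + tvIoo g u₁ (m + 1)) + M * (((u₂ - m : ℤ) : ℝ) / s + 1 + tvIoo g m u₂) :=
            (norm_add_le _ _).trans (add_le_add hfirst hsecond)
        _ = M * (((u₂ - m : ℤ) : ℝ) / s + 1 + 1 + (tvIoo g u₁ (m + 1) + tvIoo g m u₂)) := by ring
        _ ≤ M * (((u₂ - u₁ : ℤ) : ℝ) / s + 1 + tvIoo g u₁ u₂) := by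
            apply mul_le_mul_of_nonneg_left _ hM0
            have hlen : ((u₂ - m : ℤ) : ℝ) / s + 1 = ((u₂ - u₁ : ℤ) : ℝ) / s := by
              rw [hm]; push_cast; field_simp; ring
            linarith

end IntervalLemmas

/-! ### Sums over integer intervals as sums over `range` -/

/-- `∑_{u₁ < u < u₁+1+n} f(u) = ∑_{i<n} f(u₁+1+i)`. [folklore] -/
theorem sum_Ioo_eq_sum_range {M : Type*} [AddCommMonoid M] (f : ℤ → M) (u₁ : ℤ) (n : ℕ) :
    ∑ u ∈ Finset.Ioo u₁ (u₁ + 1 + n), f u = ∑ i ∈ Finset.range n, f (u₁ + 1 + i) := by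
  have himage : Finset.Ioo u₁ (u₁ + 1 + n) =
      (Finset.range n).image (fun i : ℕ => u₁ + 1 + i) := by
    ext x
    simp only [Finset.mem_Ioo, Finset.mem_image, Finset.mem_range]
    constructor
    · rintro ⟨h0, hk⟩
      refine ⟨(x - u₁ - 1).toNat, ?_, ?_⟩
      · have : ((x - u₁ - 1).toNat : ℤ) = x - u₁ - 1 := Int.toNat_of_nonneg (by omega)
        omega
      · have : ((x - u₁ - 1).toNat : ℤ) = x - u₁ - 1 := Int.toNat_of_nonneg (by omega)
        omega
    · rintro ⟨i, hi, rfl⟩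
      constructor <;> omega
  have hinj : Set.InjOn (fun i : ℕ => u₁ + 1 + i) (Finset.range n : Set ℕ) := by
    intro i _ j _ hij
    have : (i : ℤ) = j := by simpa using hij
    exact_mod_cast this
  rw [himage, Finset.sum_image hinj]

/-- A version with the endpoint `u₂` (`u₁ ≤ u₂ - 1`): `Ioo u₁ u₂ = Ioo u₁ (u₁ + 1 + n)`,
`n = u₂ - u₁ - 1`. [folklore] -/
theorem Ioo_eq_Ioo_add {u₁ u₂ : ℤ} (h : u₁ + 1 ≤ u₂) :
    Finset.Ioo u₁ u₂ = Finset.Ioo u₁ (u₁ + 1 + ((u₂ - u₁ - 1).toNat : ℕ)) := by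
  have : (((u₂ - u₁ - 1).toNat : ℕ) : ℤ) = u₂ - u₁ - 1 := Int.toNat_of_nonneg (by omega)
  rw [this]; congr 1; ring

/-- **Telescoping of a monotone sequence along an interval**: if `x` is monotone or antitone on
`[u₁+1, u₂−1]` and `lo ≤ x ≤ hi` there, then `∑_{u₁<u, u+1<u₂} |x(u+1) − x(u)| ≤ hi − lo`.
[folklore] -/
theorem sum_Ioo_abs_sub_le_of_monotone (x : ℤ → ℝ) {u₁ u₂ : ℤ} {lo hi : ℝ}
    (hb : ∀ u, u₁ < u → u < u₂ → lo ≤ x u ∧ x u ≤ hi) (hlohi : lo ≤ hi)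
    (hmono : (∀ u, u₁ < u → u + 1 < u₂ → x u ≤ x (u + 1)) ∨
      (∀ u, u₁ < u → u + 1 < u₂ → x (u + 1) ≤ x u)) :
    ∑ u ∈ Finset.Ioo u₁ (u₂ - 1), |x (u + 1) - x u| ≤ hi - lo := by
  rcases lt_or_ge (u₁ + 1) (u₂ - 1) with hne | hemp
  · set n : ℕ := (u₂ - 1 - u₁ - 1).toNat with hn
    have hncast : (n : ℤ) = u₂ - 1 - u₁ - 1 := Int.toNat_of_nonneg (by omega)
    rw [Ioo_eq_Ioo_add (by omega : u₁ + 1 ≤ u₂ - 1), sum_Ioo_eq_sum_range]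
    rw [← hn]
    set y : ℕ → ℝ := fun i => x (u₁ + 1 + i) with hy
    have hy' : ∀ i : ℕ, x (u₁ + 1 + i + 1) = y (i + 1) := fun i => by
      simp only [hy]; push_cast; ring_nf
    have hfirst : lo ≤ y 0 := by simp only [hy]; exact (hb _ (by omega) (by push_cast; omega)).1
    have hlast : y n ≤ hi := by simp only [hy]; exact (hb _ (by omega) (by omega)).2
    have hfirst' : y 0 ≤ hi := by simp only [hy]; exact (hb _ (by omega) (by push_cast; omega)).2
    have hlast' : lo ≤ y n := by simp only [hy]; exact (hb _ (by omega) (by omega)).1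
    rcases hmono with hmono | hmono
    · have hstep : ∀ i ∈ Finset.range n, |x (u₁ + 1 + i + 1) - x (u₁ + 1 + i)| = y (i + 1) - y i := by
        intro i hi
        rw [Finset.mem_range] at hi
        have hi' : (i : ℤ) < n := by exact_mod_cast hi
        have := hmono (u₁ + 1 + i) (by omega) (by omega)
        rw [hy'] at this ⊢
        change y i ≤ y (i + 1) at this
        rw [show x (u₁ + 1 + (i : ℕ)) = y i from rfl, abs_of_nonneg (by linarith)]
      rw [Finset.sum_congr rfl hstep, Finset.sum_range_sub]
      linarith
    · have hstep : ∀ i ∈ Finset.range n, |x (u₁ + 1 + i + 1) - x (u₁ + 1 + i)| = y i - y (i + 1) := by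
        intro i hi
        rw [Finset.mem_range] at hi
        have hi' : (i : ℤ) < n := by exact_mod_cast hi
        have := hmono (u₁ + 1 + i) (by omega) (by omega)
        rw [hy'] at this ⊢
        change y (i + 1) ≤ y i at this
        rw [show x (u₁ + 1 + (i : ℕ)) = y i from rfl, abs_of_nonpos (by linarith)]
        ring
      rw [Finset.sum_congr rfl hstep, Finset.sum_range_sub']
      linarith
  · have : Finset.Ioo u₁ (u₂ - 1) = ∅ := by
      ext u; simp only [Finset.mem_Ioo, Finset.notMem_empty, iff_false]; omega
    rw [this, Finset.sum_empty]; linarith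

/-! ### `∑ 1/P(u) ≤ 7/√T` along an interval when `P ≥ max(T, (u − u₀)²)` -/

/-- The far points on the right: `∑_{u ∈ (u₁,u₂), u ≥ u₀ + w + 1} 1/(u − u₀)² ≤ 1/w` (`w ≥ 1`)
(`1/(u−u₀)² ≤ 1/(u−1−u₀) − 1/(u−u₀)` telescopes). [folklore] -/
theorem sum_Ioo_filter_inv_sq_le_right {u₁ u₂ : ℤ} {u₀ w : ℝ} (hw : 1 ≤ w) :
    ∑ u ∈ (Finset.Ioo u₁ u₂).filter (fun u : ℤ => u₀ + w + 1 ≤ u), 1 / ((u : ℝ) - u₀) ^ 2 ≤ 1 / w := by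
  -- the filtered set is the interval `(m - 1, u₂)` with `m = max (u₁+1) ⌈u₀+w+1⌉`
  set m : ℤ := max (u₁ + 1) ⌈u₀ + w + 1⌉ with hm
  have hfilt : (Finset.Ioo u₁ u₂).filter (fun u : ℤ => u₀ + w + 1 ≤ u) = Finset.Ioo (m - 1) u₂ := by
    ext u
    simp only [Finset.mem_filter, Finset.mem_Ioo, hm]
    constructor
    · rintro ⟨⟨h1, h2⟩, h3⟩
      refine ⟨?_, h2⟩
      have : ⌈u₀ + w + 1⌉ ≤ u := Int.ceil_le.mpr h3
      omega
    · rintro ⟨h1, h2⟩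
      have h3 : ⌈u₀ + w + 1⌉ ≤ u := by omega
      exact ⟨⟨by omega, h2⟩, Int.ceil_le.mp h3⟩
  rw [hfilt]
  have hmge : u₀ + w + 1 ≤ (m : ℝ) := by
    have : (⌈u₀ + w + 1⌉ : ℝ) ≤ (m : ℝ) := by exact_mod_cast le_max_right (u₁ + 1) ⌈u₀ + w + 1⌉
    exact (Int.le_ceil _).trans this
  rcases lt_or_ge (m - 1 + 1) u₂ with hne | hemp
  · rw [Ioo_eq_Ioo_add (by omega : m - 1 + 1 ≤ u₂), sum_Ioo_eq_sum_range]
    set n : ℕ := (u₂ - (m - 1) - 1).toNat with hn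
    set G : ℕ → ℝ := fun i => 1 / ((m : ℝ) - 1 + i - u₀) with hG
    have hstep : ∀ i ∈ Finset.range n,
        1 / (((m - 1 + 1 + (i : ℕ) : ℤ) : ℝ) - u₀) ^ 2 ≤ G i - G (i + 1) := by
      intro i _
      have hi0 : (0 : ℝ) ≤ i := Nat.cast_nonneg i
      have hx : w + 1 ≤ (m : ℝ) + i - u₀ := by linarith
      have hx1 : 0 < (m : ℝ) - 1 + i - u₀ := by linarith
      have hx2 : 0 < (m : ℝ) + i - u₀ := by linarith
      have h1 : (((m - 1 + 1 + (i : ℕ) : ℤ) : ℝ) - u₀) = (m : ℝ) + i - u₀ := by push_cast; ring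
      have h2 : G (i + 1) = 1 / ((m : ℝ) + i - u₀) := by
        simp only [hG]; push_cast; ring_nf
      have h3 : G i = 1 / ((m : ℝ) - 1 + i - u₀) := by simp only [hG]
      rw [h1, h2, h3, div_sub_div _ _ hx1.ne' hx2.ne', div_le_div_iff₀ (by positivity) (mul_pos hx1 hx2)]
      nlinarith
    calc _ ≤ ∑ i ∈ Finset.range n, (G i - G (i + 1)) := Finset.sum_le_sum hstep
      _ = G 0 - G n := Finset.sum_range_sub' G n
      _ ≤ G 0 := by
          have : 0 ≤ G n := by
            simp only [hG]
            have : 0 < (m : ℝ) - 1 + n - u₀ := by have := Nat.cast_nonneg (α := ℝ) n; linarith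
            positivity
          linarith
      _ ≤ 1 / w := by
          simp only [hG, Nat.cast_zero, add_zero]
          exact one_div_le_one_div_of_le (by linarith) (by linarith)
  · have : Finset.Ioo (m - 1) u₂ = ∅ := by
      ext u; simp only [Finset.mem_Ioo, Finset.notMem_empty, iff_false]; omega
    rw [this, Finset.sum_empty]; positivity

/-- The far points on the left: `∑_{u ∈ (u₁,u₂), u ≤ u₀ − w − 1} 1/(u − u₀)² ≤ 1/w` (`w ≥ 1`), by
the reflection `u ↦ −u`. [folklore] -/
theorem sum_Ioo_filter_inv_sq_le_left {u₁ u₂ : ℤ} {u₀ w : ℝ} (hw : 1 ≤ w) :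
    ∑ u ∈ (Finset.Ioo u₁ u₂).filter (fun u : ℤ => (u : ℝ) ≤ u₀ - w - 1), 1 / ((u : ℝ) - u₀) ^ 2 ≤ 1 / w := by
  have h := sum_Ioo_filter_inv_sq_le_right (u₁ := -u₂) (u₂ := -u₁) (u₀ := -u₀) hw
  have himage : (Finset.Ioo u₁ u₂).filter (fun u : ℤ => (u : ℝ) ≤ u₀ - w - 1) =
      ((Finset.Ioo (-u₂) (-u₁)).filter (fun u : ℤ => -u₀ + w + 1 ≤ u)).image (fun u : ℤ => -u) := by
    ext u
    simp only [Finset.mem_filter, Finset.mem_Ioo, Finset.mem_image]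
    constructor
    · rintro ⟨⟨h1, h2⟩, h3⟩
      refine ⟨-u, ⟨⟨by omega, by omega⟩, ?_⟩, by ring⟩
      push_cast; linarith
    · rintro ⟨v, ⟨⟨h1, h2⟩, h3⟩, rfl⟩
      refine ⟨⟨by omega, by omega⟩, ?_⟩
      push_cast; linarith
  rw [himage, Finset.sum_image (fun x _ y _ (hxy : -x = -y) => neg_injective hxy)]
  refine le_trans (le_of_eq (Finset.sum_congr rfl fun u _ => ?_)) h
  push_cast; ring

/-- The near points: at most `2w + 3` integers `u` have `|u − u₀| < w + 1`. [folklore] -/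
theorem card_filter_abs_sub_lt_le {u₁ u₂ : ℤ} (u₀ w : ℝ) (hw : 0 ≤ w) :
    (((Finset.Ioo u₁ u₂).filter (fun u : ℤ => |(u : ℝ) - u₀| < w + 1)).card : ℝ) ≤ 2 * w + 3 := by
  have hsub : (Finset.Ioo u₁ u₂).filter (fun u : ℤ => |(u : ℝ) - u₀| < w + 1) ⊆
      Finset.Ioo ⌊u₀ - w - 1⌋ ⌈u₀ + w + 1⌉ := by
    intro u hu
    rw [Finset.mem_filter] at hu
    obtain ⟨h1, h2⟩ := abs_lt.mp hu.2
    rw [Finset.mem_Ioo]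
    constructor
    · by_contra hle
      push Not at hle
      have : (u : ℝ) ≤ ⌊u₀ - w - 1⌋ := by exact_mod_cast hle
      have := this.trans (Int.floor_le _)
      linarith
    · by_contra hle
      push Not at hle
      have : (⌈u₀ + w + 1⌉ : ℝ) ≤ u := by exact_mod_cast hle
      have := (Int.le_ceil _).trans this
      linarith
  have h1 := Finset.card_le_card hsub
  rw [Int.card_Ioo] at h1
  have h2 : ((((Finset.Ioo u₁ u₂).filter (fun u : ℤ => |(u : ℝ) - u₀| < w + 1)).card : ℕ) : ℝ) ≤
      ((⌈u₀ + w + 1⌉ - ⌊u₀ - w - 1⌋ - 1).toNat : ℝ) := by exact_mod_cast h1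
  refine h2.trans ?_
  have h3 : ((⌈u₀ + w + 1⌉ - ⌊u₀ - w - 1⌋ - 1 : ℤ) : ℝ) ≤ 2 * w + 3 := by
    push_cast
    have := Int.ceil_lt_add_one (u₀ + w + 1)
    have := Int.lt_floor_add_one (u₀ - w - 1)
    linarith
  rcases le_or_gt 0 (⌈u₀ + w + 1⌉ - ⌊u₀ - w - 1⌋ - 1) with h0 | h0
  · have : (((⌈u₀ + w + 1⌉ - ⌊u₀ - w - 1⌋ - 1).toNat : ℕ) : ℝ) =
        ((⌈u₀ + w + 1⌉ - ⌊u₀ - w - 1⌋ - 1 : ℤ) : ℝ) := by exact_mod_cast Int.toNat_of_nonneg h0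
    rw [this]; exact h3
  · rw [Int.toNat_of_nonpos h0.le]; simp; linarith

/-- **`∑_{u₁<u<u₂} 1/P(u) ≤ 7/√T`** when `P(u) ≥ T ≥ 1` and `P(u) ≥ (u − u₀)²` on the interval.
[folklore] -/
theorem sum_inv_le_of_sq_le {u₁ u₂ : ℤ} {P : ℤ → ℝ} {T u₀ : ℝ} (hT : 1 ≤ T)
    (hPT : ∀ u, u₁ < u → u < u₂ → T ≤ P u) (hPsq : ∀ u, u₁ < u → u < u₂ → ((u : ℝ) - u₀) ^ 2 ≤ P u) :
    ∑ u ∈ Finset.Ioo u₁ u₂, 1 / P u ≤ 7 / Real.sqrt T := by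
  set w : ℝ := Real.sqrt T with hw
  have hw1 : 1 ≤ w := by rw [hw, ← Real.sqrt_one]; exact Real.sqrt_le_sqrt hT
  have hw0 : 0 < w := by linarith
  have hwT : w ^ 2 = T := by rw [hw, Real.sq_sqrt (by linarith)]
  have hP0 : ∀ u ∈ Finset.Ioo u₁ u₂, 0 < P u := by
    intro u hu; rw [Finset.mem_Ioo] at hu; linarith [hPT u hu.1 hu.2]
  -- split into near and far points
  set near := (Finset.Ioo u₁ u₂).filter (fun u : ℤ => |(u : ℝ) - u₀| < w + 1) with hnear
  set far := (Finset.Ioo u₁ u₂).filter (fun u : ℤ => ¬ |(u : ℝ) - u₀| < w + 1) with hfar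
  have hsplit := (Finset.sum_filter_add_sum_filter_not (Finset.Ioo u₁ u₂)
    (fun u : ℤ => |(u : ℝ) - u₀| < w + 1) (fun u => 1 / P u)).symm
  rw [hsplit]
  -- near: `#near / T ≤ (2w+3)/w² ≤ 5/w`
  have hnearS : ∑ u ∈ near, 1 / P u ≤ 5 / w := by
    have h1 : ∀ u ∈ near, 1 / P u ≤ 1 / T := by
      intro u hu
      rw [hnear, Finset.mem_filter, Finset.mem_Ioo] at hu
      exact one_div_le_one_div_of_le (by linarith) (hPT u hu.1.1 hu.1.2)
    calc ∑ u ∈ near, 1 / P u ≤ ∑ u ∈ near, 1 / T := Finset.sum_le_sum h1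
      _ = (near.card : ℝ) * (1 / T) := by rw [Finset.sum_const, nsmul_eq_mul]
      _ ≤ (2 * w + 3) * (1 / T) :=
          mul_le_mul_of_nonneg_right (card_filter_abs_sub_lt_le u₀ w hw0.le) (by positivity)
      _ = (2 * w + 3) / w ^ 2 := by rw [hwT]; ring
      _ ≤ 5 / w := by
          rw [div_le_div_iff₀ (by positivity) hw0]
          nlinarith
  -- far: right and left parts, `1/P ≤ 1/(u-u₀)²`
  have hfarS : ∑ u ∈ far, 1 / P u ≤ 2 / w := by
    have hle : ∀ u ∈ far, 1 / P u ≤ 1 / ((u : ℝ) - u₀) ^ 2 := by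
      intro u hu
      rw [hfar, Finset.mem_filter, Finset.mem_Ioo] at hu
      have hsq : 0 < ((u : ℝ) - u₀) ^ 2 := by
        have h' : w + 1 ≤ |(u : ℝ) - u₀| := le_of_not_gt hu.2
        calc (0 : ℝ) < (w + 1) ^ 2 := by positivity
          _ ≤ |(u : ℝ) - u₀| ^ 2 := pow_le_pow_left₀ (by positivity) h' 2
          _ = ((u : ℝ) - u₀) ^ 2 := sq_abs _
      exact one_div_le_one_div_of_le hsq (hPsq u hu.1.1 hu.1.2)
    have hsub : far ⊆ (Finset.Ioo u₁ u₂).filter (fun u : ℤ => u₀ + w + 1 ≤ u) ∪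
        (Finset.Ioo u₁ u₂).filter (fun u : ℤ => (u : ℝ) ≤ u₀ - w - 1) := by
      intro u hu
      rw [hfar, Finset.mem_filter] at hu
      have h' : w + 1 ≤ |(u : ℝ) - u₀| := le_of_not_gt hu.2
      rw [Finset.mem_union, Finset.mem_filter, Finset.mem_filter]
      rcases le_abs'.mp h' with h'' | h''
      · right; exact ⟨hu.1, by linarith⟩
      · left; exact ⟨hu.1, by linarith⟩
    calc ∑ u ∈ far, 1 / P u ≤ ∑ u ∈ far, 1 / ((u : ℝ) - u₀) ^ 2 := Finset.sum_le_sum hle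
      _ ≤ ∑ u ∈ (Finset.Ioo u₁ u₂).filter (fun u : ℤ => u₀ + w + 1 ≤ u) ∪
            (Finset.Ioo u₁ u₂).filter (fun u : ℤ => (u : ℝ) ≤ u₀ - w - 1), 1 / ((u : ℝ) - u₀) ^ 2 :=
          Finset.sum_le_sum_of_subset_of_nonneg hsub fun _ _ _ => by positivity
      _ = ∑ u ∈ (Finset.Ioo u₁ u₂).filter (fun u : ℤ => u₀ + w + 1 ≤ u), 1 / ((u : ℝ) - u₀) ^ 2 +
            ∑ u ∈ (Finset.Ioo u₁ u₂).filter (fun u : ℤ => (u : ℝ) ≤ u₀ - w - 1),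
              1 / ((u : ℝ) - u₀) ^ 2 := by
          apply Finset.sum_union
          rw [Finset.disjoint_left]
          intro u h1 h2
          rw [Finset.mem_filter] at h1 h2
          linarith [h1.2, h2.2]
      _ ≤ 1 / w + 1 / w :=
          add_le_add (sum_Ioo_filter_inv_sq_le_right hw1) (sum_Ioo_filter_inv_sq_le_left hw1)
      _ = 2 / w := by ring
  calc ∑ u ∈ near, 1 / P u + ∑ u ∈ far, 1 / P u ≤ 5 / w + 2 / w := add_le_add hnearS hfarS
    _ = 7 / w := by ring

/-! ### The variation of the twist along a slice -/

/-- `Φ(u+1, s) = Φ(u, s) + ℓ + A`, `ℓ = 2Au + Bs`. [folklore] -/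
theorem eval_succ_eq (Φ : BinQF) (u s : ℤ) :
    Φ.eval (u + 1) s = Φ.eval u s + (2 * Φ.a * u + Φ.b * s) + Φ.a := by
  simp only [BinQF.eval]; ring

/-- An integer is at most its square in absolute value. [folklore] -/
theorem int_abs_le_sq (l : ℤ) : |(l : ℝ)| ≤ (l : ℝ) ^ 2 := by
  rcases eq_or_ne l 0 with h | h
  · simp [h]
  · have h1 : (1 : ℝ) ≤ |(l : ℝ)| := by
      have : 1 ≤ |l| := Int.one_le_abs h
      have : ((1 : ℤ) : ℝ) ≤ ((|l| : ℤ) : ℝ) := by exact_mod_cast this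
      simpa using this
    calc |(l : ℝ)| = |(l : ℝ)| * 1 := (mul_one _).symm
      _ ≤ |(l : ℝ)| * |(l : ℝ)| := mul_le_mul_of_nonneg_left h1 (abs_nonneg _)
      _ = (l : ℝ) ^ 2 := by rw [← sq, sq_abs]

/-- **The increment of `f₁ = ℓ/(2sP)`**: with `P' = P + ℓ + A`, `ℓ' = ℓ + 2A`, `A ≥ 1`, `P, P' > 0`,
`|ℓ| ≤ ℓ²` and `ℓ² ≤ κ A P`: `|ℓ'/(2sP') − ℓ/(2sP)| ≤ (1+κ) A²/(s P')`
(`ℓ'P − ℓP' = 2AP − ℓ² − Aℓ`). [folklore] -/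
theorem abs_f1_succ_sub_le {A P P' l s κ : ℝ} (hA : 1 ≤ A) (hP : 0 < P) (hP' : 0 < P') (hs : 0 < s)
    (hPP : P' = P + l + A) (hl : |l| ≤ l ^ 2) (hlκ : l ^ 2 ≤ κ * A * P) :
    |(l + 2 * A) / (2 * s * P') - l / (2 * s * P)| ≤ (1 + κ) * A ^ 2 / (s * P') := by
  have hnum : (l + 2 * A) / (2 * s * P') - l / (2 * s * P) = (2 * A * P - l ^ 2 - A * l) / (2 * s * P * P') := by
    rw [div_sub_div _ _ (by positivity : (2 : ℝ) * s * P' ≠ 0) (by positivity : (2 : ℝ) * s * P ≠ 0),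
      div_eq_div_iff (by positivity) (by positivity), hPP]
    ring
  rw [hnum, abs_div, abs_of_pos (by positivity : (0 : ℝ) < 2 * s * P * P')]
  rw [div_le_div_iff₀ (by positivity) (by positivity)]
  have h1 : |2 * A * P - l ^ 2 - A * l| ≤ 2 * A * P + l ^ 2 + A * |l| := by
    calc |2 * A * P - l ^ 2 - A * l| ≤ |2 * A * P - l ^ 2| + |A * l| := abs_sub _ _
      _ ≤ (|2 * A * P| + |l ^ 2|) + |A * l| := add_le_add (abs_sub _ _) le_rfl
      _ = 2 * A * P + l ^ 2 + A * |l| := by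
          rw [abs_of_pos (by positivity : (0 : ℝ) < 2 * A * P), abs_of_nonneg (sq_nonneg l),
            abs_mul, abs_of_pos (by linarith : (0 : ℝ) < A)]
  have h2 : 2 * A * P + l ^ 2 + A * |l| ≤ (2 + 2 * κ) * A ^ 2 * P := by
    have h3 : A * |l| ≤ A * l ^ 2 := mul_le_mul_of_nonneg_left hl (by linarith)
    have hl2 : 0 ≤ l ^ 2 := sq_nonneg l
    have h4a : l ^ 2 ≤ A * l ^ 2 := by nlinarith
    have h4b : A * l ^ 2 ≤ A * (κ * A * P) := mul_le_mul_of_nonneg_left hlκ (by linarith)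
    have h5 : 2 * A * P ≤ 2 * A ^ 2 * P := by
      have : A * P ≤ A ^ 2 * P := by
        rw [sq, mul_assoc]; exact le_mul_of_one_le_left (by positivity) hA
      linarith
    calc 2 * A * P + l ^ 2 + A * |l| ≤ 2 * A * P + (A * l ^ 2 + A * l ^ 2) := by linarith
      _ ≤ 2 * A ^ 2 * P + (A * (κ * A * P) + A * (κ * A * P)) := by linarith
      _ = (2 + 2 * κ) * A ^ 2 * P := by ring
  calc |2 * A * P - l ^ 2 - A * l| * (s * P') ≤ (2 + 2 * κ) * A ^ 2 * P * (s * P') := by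
        apply mul_le_mul_of_nonneg_right (h1.trans h2) (by positivity)
    _ = (1 + κ) * A ^ 2 * (2 * s * P * P') := by ring

/-- **The increments of the twist**: `‖twistG(u+1) − twistG(u)‖ ≤ 2π|h| (|Δf₁| + |Δf₂|)` with
`f₁ = ℓ/(2sP)`, `f₂ = b/(2P)`. [folklore] -/
theorem norm_twistG_succ_sub_le (b : ℤ) (Φ : BinQF) (h : ℤ) (s : ℕ) (u : ℤ) :
    ‖twistG b Φ h s (u + 1) - twistG b Φ h s u‖ ≤
      2 * Real.pi * |(h : ℝ)| *
        (|((2 * Φ.a * (u + 1 : ℤ) + Φ.b * s : ℤ) : ℝ) / (2 * s * (Φ.eval (u + 1) s : ℝ)) -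
            ((2 * Φ.a * u + Φ.b * s : ℤ) : ℝ) / (2 * s * (Φ.eval u s : ℝ))| +
          |(b : ℝ) / (2 * (Φ.eval (u + 1) s : ℝ)) - (b : ℝ) / (2 * (Φ.eval u s : ℝ))|) := by
  unfold twistG
  refine (norm_fourierChar_sub_le _ _).trans ?_
  rw [mul_assoc (2 * Real.pi)]
  refine mul_le_mul_of_nonneg_left ?_ (by positivity)
  push_cast
  set X₁ : ℝ := (2 * (Φ.a : ℝ) * ((u : ℝ) + 1) + (Φ.b : ℝ) * (s : ℝ)) / (2 * (s : ℝ) * (Φ.eval (u + 1) s : ℝ))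
  set X₀ : ℝ := (2 * (Φ.a : ℝ) * (u : ℝ) + (Φ.b : ℝ) * (s : ℝ)) / (2 * (s : ℝ) * (Φ.eval u s : ℝ))
  set Y₁ : ℝ := (b : ℝ) / (2 * (Φ.eval (u + 1) s : ℝ))
  set Y₀ : ℝ := (b : ℝ) / (2 * (Φ.eval u s : ℝ))
  have : -((h : ℝ) * (X₁ + Y₁)) - -((h : ℝ) * (X₀ + Y₀)) = -((h : ℝ) * ((X₁ - X₀) + (Y₁ - Y₀))) := by ring
  rw [this, abs_neg, abs_mul]
  exact mul_le_mul_of_nonneg_left (abs_add_le _ _) (abs_nonneg _)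

/-- **The total variation of the twist along a monotone piece of a slice**: if on `(u₁, u₂)` the
slice quadratic `P(u) = Φ(u, s)` is monotone, `P ≥ T₁ ≥ 1`, `P ≥ (u − u₀)²` and `ℓ² ≤ κ A P`
(`A = Φ.a ≥ 1`), then
`tvIoo twistG u₁ u₂ ≤ 2π|h| (7(1+κ)A²/(s√T₁) + |b|/(2T₁))`. [cite: IwaniecInventiones1978, §4 p. 180] -/
theorem tvIoo_twistG_le (b : ℤ) {Φ : BinQF} (hA : 1 ≤ Φ.a) (h : ℤ) {s : ℕ} (hs : 1 ≤ s)
    {u₁ u₂ : ℤ} {T₁ u₀ κ : ℝ} (hT₁ : 1 ≤ T₁) (hκ : 0 ≤ κ)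
    (hPT : ∀ u, u₁ < u → u < u₂ → T₁ ≤ (Φ.eval u s : ℝ))
    (hPsq : ∀ u, u₁ < u → u < u₂ → ((u : ℝ) - u₀) ^ 2 ≤ (Φ.eval u s : ℝ))
    (hℓ : ∀ u, u₁ < u → u < u₂ → ((2 * Φ.a * u + Φ.b * s : ℤ) : ℝ) ^ 2 ≤ κ * Φ.a * (Φ.eval u s : ℝ))
    (hmono : (∀ u, u₁ < u → u + 1 < u₂ → Φ.eval u s ≤ Φ.eval (u + 1) s) ∨
      (∀ u, u₁ < u → u + 1 < u₂ → Φ.eval (u + 1) s ≤ Φ.eval u s)) :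
    tvIoo (twistG b Φ h s) u₁ u₂ ≤
      2 * Real.pi * |(h : ℝ)| * (7 * (1 + κ) * (Φ.a : ℝ) ^ 2 / (s * Real.sqrt T₁) + |(b : ℝ)| / (2 * T₁)) := by
  have hA' : (1 : ℝ) ≤ Φ.a := by exact_mod_cast hA
  have hs' : (0 : ℝ) < s := by exact_mod_cast hs
  have hT0 : 0 < T₁ := by linarith
  set P : ℤ → ℝ := fun u => (Φ.eval u s : ℝ) with hPdef
  set L : ℤ → ℝ := fun u => ((2 * Φ.a * u + Φ.b * s : ℤ) : ℝ) with hLdef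
  have hP0 : ∀ u, u₁ < u → u < u₂ → 0 < P u := fun u h1 h2 => by
    have := hPT u h1 h2; simp only [hPdef]; linarith
  -- the two increments
  have hΔ₁ : ∀ u, u₁ < u → u + 1 < u₂ →
      |L (u + 1) / (2 * s * P (u + 1)) - L u / (2 * s * P u)| ≤ (1 + κ) * (Φ.a : ℝ) ^ 2 / (s * P (u + 1)) := by
    intro u h1 h2
    have hPu := hP0 u h1 (by omega)
    have hPu' := hP0 (u + 1) (by omega) h2
    have hLsucc : L (u + 1) = L u + 2 * Φ.a := by simp only [hLdef]; push_cast; ring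
    have hPsucc : P (u + 1) = P u + L u + Φ.a := by
      simp only [hPdef, hLdef]; rw [eval_succ_eq]; push_cast; ring
    rw [hLsucc]
    exact abs_f1_succ_sub_le hA' hPu hPu' hs' hPsucc (by simp only [hLdef]; exact int_abs_le_sq _)
      (hℓ u h1 (by omega))
  have hΔ₂ : ∀ u, (b : ℝ) / (2 * P (u + 1)) - (b : ℝ) / (2 * P u) = (b : ℝ) / 2 * (1 / P (u + 1) - 1 / P u) := by
    intro u; ring
  -- sum of the first increments
  have hS₁ : ∑ u ∈ Finset.Ioo u₁ (u₂ - 1), |L (u + 1) / (2 * s * P (u + 1)) - L u / (2 * s * P u)| ≤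
      (1 + κ) * (Φ.a : ℝ) ^ 2 / s * (7 / Real.sqrt T₁) := by
    have h1 : ∑ u ∈ Finset.Ioo u₁ (u₂ - 1), |L (u + 1) / (2 * s * P (u + 1)) - L u / (2 * s * P u)| ≤
        ∑ u ∈ Finset.Ioo u₁ (u₂ - 1), (1 + κ) * (Φ.a : ℝ) ^ 2 / s * (1 / P (u + 1)) := by
      refine Finset.sum_le_sum fun u hu => ?_
      rw [Finset.mem_Ioo] at hu
      refine (hΔ₁ u hu.1 (by omega)).trans (le_of_eq ?_)
      have := hP0 (u + 1) (by omega) (by omega)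
      field_simp
    refine h1.trans ?_
    rw [← Finset.mul_sum]
    refine mul_le_mul_of_nonneg_left ?_ (by positivity)
    -- reindex `u + 1 = u'` and apply `sum_inv_le_of_sq_le` on `(u₁ + 1, u₂)`
    have himage : (Finset.Ioo u₁ (u₂ - 1)).image (fun u : ℤ => u + 1) = Finset.Ioo (u₁ + 1) u₂ := by
      ext x; simp only [Finset.mem_image, Finset.mem_Ioo]
      constructor
      · rintro ⟨u, ⟨h1, h2⟩, rfl⟩; constructor <;> omega
      · rintro ⟨h1, h2⟩; exact ⟨x - 1, ⟨by omega, by omega⟩, by ring⟩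
    have h2 : ∑ u ∈ Finset.Ioo u₁ (u₂ - 1), 1 / P (u + 1) = ∑ u ∈ Finset.Ioo (u₁ + 1) u₂, 1 / P u := by
      rw [← himage, Finset.sum_image (fun x _ y _ (hxy : x + 1 = y + 1) => by omega)]
    rw [h2]
    exact sum_inv_le_of_sq_le hT₁ (fun u h1 h2 => hPT u (by omega) h2) (fun u h1 h2 => hPsq u (by omega) h2)
  -- sum of the second increments (telescoping)
  have hS₂ : ∑ u ∈ Finset.Ioo u₁ (u₂ - 1), |(b : ℝ) / (2 * P (u + 1)) - (b : ℝ) / (2 * P u)| ≤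
      |(b : ℝ)| / 2 * (1 / T₁) := by
    have h1 : ∀ u ∈ Finset.Ioo u₁ (u₂ - 1), |(b : ℝ) / (2 * P (u + 1)) - (b : ℝ) / (2 * P u)| =
        |(b : ℝ)| / 2 * |1 / P (u + 1) - 1 / P u| := by
      intro u _; rw [hΔ₂, abs_mul, abs_div, abs_two]
    rw [Finset.sum_congr rfl h1, ← Finset.mul_sum]
    refine mul_le_mul_of_nonneg_left ?_ (by positivity)
    have hb' : ∀ u, u₁ < u → u < u₂ → 0 ≤ 1 / P u ∧ 1 / P u ≤ 1 / T₁ := fun u h1 h2 =>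
      ⟨by have := hP0 u h1 h2; positivity, one_div_le_one_div_of_le hT0 (hPT u h1 h2)⟩
    have hmono' : (∀ u, u₁ < u → u + 1 < u₂ → 1 / P u ≤ 1 / P (u + 1)) ∨
        (∀ u, u₁ < u → u + 1 < u₂ → 1 / P (u + 1) ≤ 1 / P u) := by
      rcases hmono with hm | hm
      · right; intro u h1 h2
        exact one_div_le_one_div_of_le (hP0 u h1 (by omega)) (by simp only [hPdef]; exact_mod_cast hm u h1 h2)
      · left; intro u h1 h2
        exact one_div_le_one_div_of_le (hP0 (u + 1) (by omega) h2) (by simp only [hPdef]; exact_mod_cast hm u h1 h2)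
    have := sum_Ioo_abs_sub_le_of_monotone (fun u => 1 / P u) hb' (by positivity) hmono'
    simpa using this
  -- assemble
  unfold tvIoo
  calc ∑ u ∈ Finset.Ioo u₁ (u₂ - 1), ‖twistG b Φ h s (u + 1) - twistG b Φ h s u‖
      ≤ ∑ u ∈ Finset.Ioo u₁ (u₂ - 1), 2 * Real.pi * |(h : ℝ)| *
          (|L (u + 1) / (2 * s * P (u + 1)) - L u / (2 * s * P u)| +
            |(b : ℝ) / (2 * P (u + 1)) - (b : ℝ) / (2 * P u)|) :=
        Finset.sum_le_sum fun u _ => norm_twistG_succ_sub_le b Φ h s u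
    _ = 2 * Real.pi * |(h : ℝ)| *
          (∑ u ∈ Finset.Ioo u₁ (u₂ - 1), |L (u + 1) / (2 * s * P (u + 1)) - L u / (2 * s * P u)| +
            ∑ u ∈ Finset.Ioo u₁ (u₂ - 1), |(b : ℝ) / (2 * P (u + 1)) - (b : ℝ) / (2 * P u)|) := by
        rw [mul_add, Finset.mul_sum, Finset.mul_sum, ← Finset.sum_add_distrib]
        refine Finset.sum_congr rfl fun u _ => by ring
    _ ≤ 2 * Real.pi * |(h : ℝ)| * ((1 + κ) * (Φ.a : ℝ) ^ 2 / s * (7 / Real.sqrt T₁) + |(b : ℝ)| / 2 * (1 / T₁)) :=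
        mul_le_mul_of_nonneg_left (add_le_add hS₁ hS₂) (by positivity)
    _ = _ := by
        have : 0 < Real.sqrt T₁ := Real.sqrt_pos.mpr hT0
        field_simp

/-! ### The slice estimate -/

section Slice

variable {ε C : ℝ}

/-- **The exponential sum over a monotone piece of a slice, for a general form.**  Let `hC` be the
conclusion of Lemma 6 (exponent `ε`, constant `C ≥ 1`).  For `Φ` with `A = Φ.a ≥ 1`, a height
`s ≥ 1`, `h`, a modulus `Λ ≥ 1` and a class `λ`, and an interval `(u₁, u₂)` on which
`P(u) = Φ(u, s)` is monotone with `P ≥ T₁ ≥ 1`, `P ≥ (u − u₀)²`, `ℓ² ≤ κ A P`: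
`‖∑_{u₁<u<u₂, (u,s)=1, u≡λ (Λ)} e(h ū/s) twistG(u)‖ ≤
  C s^{1/2+ε} √(h,s) ((u₂ − u₁)/s + 1 + 2π|h| (7(1+κ)A²/(s√T₁) + |b|/(2T₁)))`.
[cite: IwaniecInventiones1978, §4 p. 180] -/
theorem norm_sliceSumG_le
    (hC : ∀ (s Λ : ℕ) (h r₁ r₂ lam : ℤ), 1 ≤ s → 1 ≤ Λ → r₁ < r₂ → r₂ - r₁ < 2 * s →
      ‖∑ r ∈ (Finset.Ioo r₁ r₂).filter (fun r : ℤ => Int.gcd r s = 1 ∧ r ≡ lam [ZMOD Λ]),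
          hooleyPhase h s r‖ ≤ C * (s : ℝ) ^ (1 / 2 + ε) * Real.sqrt (Int.gcd h s))
    (hC1 : 1 ≤ C) (b : ℤ) {Φ : BinQF} (hA : 1 ≤ Φ.a) {s Λ : ℕ} (hs : 1 ≤ s) (hΛ : 1 ≤ Λ)
    (h lam : ℤ) {u₁ u₂ : ℤ} (hle : u₁ ≤ u₂) {T₁ u₀ κ : ℝ} (hT₁ : 1 ≤ T₁) (hκ : 0 ≤ κ)
    (hPT : ∀ u, u₁ < u → u < u₂ → T₁ ≤ (Φ.eval u s : ℝ))
    (hPsq : ∀ u, u₁ < u → u < u₂ → ((u : ℝ) - u₀) ^ 2 ≤ (Φ.eval u s : ℝ))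
    (hℓ : ∀ u, u₁ < u → u < u₂ → ((2 * Φ.a * u + Φ.b * s : ℤ) : ℝ) ^ 2 ≤ κ * Φ.a * (Φ.eval u s : ℝ))
    (hmono : (∀ u, u₁ < u → u + 1 < u₂ → Φ.eval u s ≤ Φ.eval (u + 1) s) ∨
      (∀ u, u₁ < u → u + 1 < u₂ → Φ.eval (u + 1) s ≤ Φ.eval u s)) :
    ‖∑ u ∈ (Finset.Ioo u₁ u₂).filter (fun u : ℤ => Int.gcd u s = 1 ∧ u ≡ lam [ZMOD Λ]),
        hooleyPhase h s u * twistG b Φ h s u‖ ≤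
      C * (s : ℝ) ^ (1 / 2 + ε) * Real.sqrt (Int.gcd h s) *
        (((u₂ - u₁ : ℤ) : ℝ) / s + 1 +
          2 * Real.pi * |(h : ℝ)| * (7 * (1 + κ) * (Φ.a : ℝ) ^ 2 / (s * Real.sqrt T₁) + |(b : ℝ)| / (2 * T₁))) := by
  have h1 := norm_sum_Ioo_filter_hooley_mul_le_long hC hC1 hs hΛ h lam (twistG b Φ h s)
    (fun u => (norm_twistG b Φ h s u).le) hle
  have h2 := tvIoo_twistG_le b hA h hs hT₁ hκ hPT hPsq hℓ hmono
  have hM0 : 0 ≤ C * (s : ℝ) ^ (1 / 2 + ε) * Real.sqrt (Int.gcd h s) := by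
    have : (0 : ℝ) ≤ C := by linarith
    positivity
  exact h1.trans (mul_le_mul_of_nonneg_left (by linarith) hM0)

end Slice

end Literature.NumberTheory.Sieve.Iwaniec1978

end
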